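import Literature.NumberTheory.GaloisCohomology.Howard2004.FiniteSingularTameTower
import Literature.NumberTheory.GaloisCohomology.Howard2004.FiniteSingularSlotUnitsTransferProofs
import Literature.NumberTheory.GaloisCohomology.Howard2004.FiniteSingularSlotUnitsProofs
import Literature.NumberTheory.GaloisCohomology.Howard2004.FiniteSingularEvaluationLinearProofs
import Literature.NumberTheory.GaloisCohomology.Howard2004.KolyvaginRelationLocalizationProofs
import Literature.NumberTheory.GaloisCohomology.Howard2004.FiniteSingularSlotUnitsInputsProofs
import Literature.NumberTheory.GaloisCohomology.Howard2004.QuotCartesianReductionProofs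
import HarnessLib

/-!
# Howard 2004, Def. 1.1.8 / §1.6: LEVELWISE units relating an admissible finite–singular slot family to the tame
# slots of a `DVRSetting`, and their compatibility across the reductions (theorems only)

Topic `NumberTheory/GaloisCohomology/Howard2004` (sequel to `FiniteSingularSlotUnitsProofs` (at ONE pair `(m, λ)`:
`fs₂ = u · fs`, `u` a unit), `FiniteSingularSlotUnitsTransferProofs` (transfer of `u` in `n` and down in `k`),
`FiniteSingularSlotUnitsInputsProofs` (their «Not here»: onto on the finite classes, unimodular pair) and
`FiniteSingularTameTower` (the tame slots)).  THEOREMS ONLY: no definition, no named fact, no instance, no notation,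
no `sorry`.

WHY (INPUTS row G87 = `Howard2004.thm161_dvrKolyvaginBound` = Howard Thm. 1.6.1; stub `stub_h161` of the μ-crux
stmt-BirchSwinnertonDyer-22642; cell `pub/bsd-print-x9`, seat `bsd-line-x10b-p1-w7` g8, brick (TAME-WLOG) «thm161
for tame-pinned settings ⇒ thm161 as typed», bsd-line-x10b-p1 LEAD g12 (O3)).  Reading note (v) of
`FiniteSingularNatural`: an admissible slot is `u_ℓ · φ^{fs}` with `u_ℓ` a unit, «compatible in `(k, n)`», and
`κ_n ↦ (∏ u_ℓ) κ_n` transports Kolyvagin systems.  The x9-p1 plan asked for ONE `u_ℓ ∈ Rˣ` for all levels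
(stationarity / completeness, not in the tree).  DESIGN DECISION HERE: the units are chosen PER LEVEL `k` (in `R_k`),
and the only compatibility the transport needs — `red(w_{k+1} ℓ)` and `w_k ℓ` act identically on `T^{(k)}/I_n`,
`λ ∈ n` — is PROVED: `red(u_{k+1} ℓ)` is valid at level `k`, and two valid scalars differ by an annihilator of
`H¹_s(K_λ, T^{(k)}/I_λ) ⊗ G_ℓ ≅ T^{(k)}/I_λ ↠ T^{(k)}/I_n`.

* §1 **`LevelData.smul_eq_smul_of_fs_eq_sqSMul`** — two scalars `a, a'` with `fs₂ = ((a•) ⊗ 1) ∘ fs = ((a'•) ⊗ 1) ∘ fs`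
  on the finite classes at `(m, λ)` (slot bijective there, `TameHyp`, `#G_ℓ·T/I_m = 0`) act identically on `T/I_mT`
  (`singularEval` at a tame generator and `· ⊗ ḡ` are bijective, Prop. 1.1.7);
* §2 (a tame-pinned `S` — `htame : (S.LD k).fs = tameSlotOn …` with the canonical guard `n ∈ 𝓝(𝓛) ∧ λ ∈ n` — against a
  second family `fs₂` admissible at every level (`h2adm`) and natural along the reductions (`h2red`; e.g. the ORIGINAL
  slots of a general setting, `SatisfiesH.fs_admissible` / `fs_natural`)) **`DVRSetting.exists_unit_fs_eq_sqSMul_level`**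
  (one level, one prime, all `nλ ∈ 𝓝(𝓛)`), **`DVRSetting.exists_levelwise_units`**: `u w : ∀ k, 𝓛 → R_k` with
  `w_k u_k = 1`, `(S.LD k).IsRescaledFs _ (fs₂ k) (u k)` at every level, and
  `S.redR k (w (k+1) λ) • y = w k λ • y` for `y : T^{(k)}/I_n`, `λ ∈ n ∈ 𝓝(𝓛)`.

HONEST FRAMING: `thm161_dvrKolyvaginBound` is NOT proved (the levelwise transport of Kolyvagin systems and the
«WLOG tame» wrapper are the sequel files); no summit statement is proved; the Birch–Swinnerton-Dyer conjecture is not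
proved by any of this.
References: [Howard2004HeegnerKolyvagin] B. Howard, Compositio Math. 140 (2004), Prop. 1.1.7, Def. 1.1.8, Def. 1.2.3,
§1.6 (arXiv:1202.6340 p. 5 L115–149, p. 6 L126 – p. 7 L12, p. 11 L45–54); Thm. 1.7.5 (p. 14 L30–44: renormalisation).
-/

set_option autoImplicit false

noncomputable section

open Function NumberField IsDedekindDomain Field
open scoped NumberField ContRepresentation Classical TensorProduct

namespace Literature.NumberTheory.GaloisCohomology.Howard2004

open Literature.NumberTheory.GaloisRepresentations
open Literature.NumberTheory.GaloisRepresentations.DiscreteGaloisModule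
open Literature.NumberTheory.GaloisRepresentations.galoisCohomology
open Literature.NumberTheory.GaloisRepresentations.IsNonarchimedeanLocalField

/-! ## §1 Two scalars relating the same pair of slots act identically on `T/I_mT` -/

namespace LevelData

variable {K : Type} [Field K] [NumberField K] {M : Type} [AddCommGroup M] [TopologicalSpace M]
  [DiscreteTopology M] {R : Type} [CommRing R] [Module R M]
  {p : ℕ} [Fact p.Prime] {ρ : DiscreteGaloisModule K M} {t : SelmerTriple p ρ}
  {N : Finset (HeightOneSpectrum (𝓞 K)) → Type} [∀ n, AddCommGroup (N n)]
  [∀ n, TopologicalSpace (N n)] [∀ n, DiscreteTopology (N n)] [∀ n, Module R (N n)]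

omit [Fact p.Prime] in
/-- **Two scalars `a`, `a'` with `fs₂ = ((a•) ⊗ 1) ∘ fs = ((a'•) ⊗ 1) ∘ fs` on the finite classes act identically
on `T/I_mT`**, at a pair `(m, λ)` where the slot `fs` is bijective on the finite classes, the local action is
trivial with `(q_λ − 1)·(T/I_mT) = 0` (`TameHyp`) and `#G_ℓ·(T/I_mT) = 0`: `H¹_s(K_λ, T/I_mT) ⊗ G_ℓ ≅ T/I_mT` by
`singularEval` at a tame generator and `· ⊗ ḡ` (Prop. 1.1.7), `R`-linearly.  (The unit of Def. 1.1.8's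
comparison is determined modulo the annihilator of `T/I_mT`.)
[cite: Howard2004HeegnerKolyvagin, Prop. 1.1.7 and Def. 1.1.8 (arXiv:1202.6340 p. 5 L129–149)] -/
theorem smul_eq_smul_of_fs_eq_sqSMul [∀ n, Finite (N n)] (D : LevelData R ρ t N) (hρ : ρ.IsScalarLinear R)
    {m : Finset (HeightOneSpectrum (𝓞 K))} (hm : m ∈ t.levelSet) {v : HeightOneSpectrum (𝓞 K)} (hv : v ∈ m)
    (htame : TameHyp D.ρq m v) (pin : TamePin v) (hbij : D.FsBijectiveAt m v)
    (fs₂ : galoisCohomology ((D.ρq m).toLocal (Sum.inr v)) 1 →+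
      SingularQuotient (GaloisRep.toLocal v (D.ρq m)) ⊗[ℤ] Gell v)
    (a a' : R)
    (ha : ∀ c ∈ unramifiedSubgroup (GaloisRep.toLocal v (D.ρq m)) 1, fs₂ c = D.sqSMul hρ m v a (D.fs m v c))
    (ha' : ∀ c ∈ unramifiedSubgroup (GaloisRep.toLocal v (D.ρq m)) 1, fs₂ c = D.sqSMul hρ m v a' (D.fs m v c))
    (y : N m) : a • y = a' • y := by
  -- (1) the two maps `(a•) ⊗ 1`, `(a'•) ⊗ 1` agree on `H¹_s ⊗ G_ℓ` (the slot is onto)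
  have h1 : ∀ z : SingularQuotient (GaloisRep.toLocal v (D.ρq m)) ⊗[ℤ] Gell v,
      D.sqSMul hρ m v a z = D.sqSMul hρ m v a' z := by
    intro z
    obtain ⟨x, rfl⟩ := hbij.2 z
    rw [← ha x x.2, ← ha' x x.2]
  -- (2) hence `H¹_s(a•) = H¹_s(a'•)` (cancel `⊗ ḡ`)
  have hG : ∀ s : SingularQuotient (GaloisRep.toLocal v (D.ρq m)), Nat.card (Gell v) • s = 0 :=
    fun s => D.natCard_gell_smul_singularQuotient_eq_zero hm hv v s
  have h2 : ∀ s : SingularQuotient (GaloisRep.toLocal v (D.ρq m)),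
      singularQuotientMap (D.ρq m) (D.ρq m) v (a • LinearMap.id : N m →ₗ[R] N m).toAddMonoidHom
          (smul_id_toLocal (D.isScalarLinear hρ m) v a) s =
        singularQuotientMap (D.ρq m) (D.ρq m) v (a' • LinearMap.id : N m →ₗ[R] N m).toAddMonoidHom
          (smul_id_toLocal (D.isScalarLinear hρ m) v a') s := by
    intro s
    apply (tmulRight_bijective pin.gbar pin.mem_zmultiples_gbar hG).1
    have h := h1 (s ⊗ₜ[ℤ] pin.gbar)
    rw [sqSMul_def, sqSMul_def, TensorProduct.map_tmul, TensorProduct.map_tmul] at h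
    exact h
  -- (3) evaluate at the tame generator: `singularEval` is onto `T/I_mT` and commutes with `H¹_s(a•)`
  obtain ⟨s, rfl⟩ := (singularEval_bijective (GaloisRep.toLocal v (D.ρq m)) htame.1 pin.isTameGenerator
    htame.2).2 y
  have e1 := singularEval_singularQuotientMap (D.ρq m) (D.ρq m) v
    (a • LinearMap.id : N m →ₗ[R] N m).toAddMonoidHom (smul_id_toLocal (D.isScalarLinear hρ m) v a)
    htame.1 htame.1 pin.gen s
  have e2 := singularEval_singularQuotientMap (D.ρq m) (D.ρq m) v
    (a' • LinearMap.id : N m →ₗ[R] N m).toAddMonoidHom (smul_id_toLocal (D.isScalarLinear hρ m) v a')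
    htame.1 htame.1 pin.gen s
  rw [h2 s] at e1
  rw [e1] at e2
  simpa using e2

end LevelData

/-! ## §2 Levelwise units on a tame-pinned `DVRSetting` against a second admissible slot family -/

namespace DVRSetting

variable {p : ℕ} [Fact p.Prime] {K : Type} [Field K] [NumberField K]
  {R : Type} [CommRing R] [IsDomain R] [IsDiscreteValuationRing R] [Algebra ℤ_[p] R]
  {N : ℕ → Type} [∀ k, AddCommGroup (N k)] [∀ k, TopologicalSpace (N k)]
  [∀ k, DiscreteTopology (N k)] [∀ k, Module R (N k)]
  {Rk : ℕ → Type} [∀ k, CommRing (Rk k)] [∀ k, IsLocalRing (Rk k)] [∀ k, TopologicalSpace (Rk k)]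
  [∀ k, DiscreteTopology (Rk k)] [∀ k, Algebra ℤ_[p] (Rk k)] [∀ k, Algebra R (Rk k)]
  [∀ k, Module (Rk k) (N k)] [∀ k, IsScalarTower R (Rk k) (N k)]
  {Nbar : Type} [AddCommGroup Nbar] [TopologicalSpace Nbar] [DiscreteTopology Nbar]
  [∀ k, Module (Rk k) Nbar]
  {Nq : ℕ → Finset (HeightOneSpectrum (𝓞 K)) → Type} [∀ k n, AddCommGroup (Nq k n)]
  [∀ k n, TopologicalSpace (Nq k n)] [∀ k n, DiscreteTopology (Nq k n)]
  [∀ k n, Module (Rk k) (Nq k n)] [∀ k n, Module R (Nq k n)]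
  [∀ k n, IsScalarTower R (Rk k) (Nq k n)] [∀ k n, Finite (Nq k n)]
  (S : DVRSetting p K R N Rk Nbar Nq) (hy : S.SatisfiesH) (pins : ∀ v : HeightOneSpectrum (𝓞 K), TamePin v)
  (hP : ∀ k n v, n ∈ levels S.L ∧ v ∈ n → TameHyp (S.LD k).ρq n v)
  (htame : ∀ k, (S.LD k).fs = tameSlotOn pins (S.LD k).ρq (fun n v => n ∈ levels S.L ∧ v ∈ n) (hP k))
  (fs₂ : ∀ k (n : Finset (HeightOneSpectrum (𝓞 K))) (v : HeightOneSpectrum (𝓞 K)),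
    galoisCohomology (((S.LD k).ρq n).toLocal (Sum.inr v)) 1 →+
      SingularQuotient (GaloisRep.toLocal v ((S.LD k).ρq n)) ⊗[ℤ] Gell v)
  (h2adm : ∀ k, ({ S.LD k with fs := fs₂ k } : LevelData (Rk k) (S.T.ρ k) (S.t k) (Nq k)).IsFsAdmissible)
  (h2red : ∀ k n (v : HeightOneSpectrum (𝓞 K))
      (x : galoisCohomology (GaloisRep.toLocal v ((S.LD (k + 1)).ρq n)) 1),
    fs₂ k n v (S.rqLocH1 k n v x) = TensorProduct.map (S.fsQ k n v).toIntLinearMap LinearMap.id (fs₂ (k + 1) n v x))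

include hy htame h2adm in
/-- **At one level `k` and one prime `λ ∈ 𝓛`: a unit `u ∈ R_kˣ` with `fs₂ = ((u•) ⊗ 1) ∘ fs_tame` on the finite
classes at EVERY pair `(nλ, λ)`, `nλ ∈ 𝓝(𝓛)`** — at `({λ}, λ)` by the commutant argument
(`exists_unit_fs_eq_sqSMul_of_natural`, unimodular pair from H.0, evaluation at the pinned Frobenius), transferred
to `(nλ, λ)` along the onto transition `T^{(k)}/I_λ ↠ T^{(k)}/I_{nλ}` (`fs_eq_sqSMul_transfer`).
[cite: Howard2004HeegnerKolyvagin, Prop. 1.1.7, Def. 1.1.8, Def. 1.2.3 (arXiv p. 5 L115–149, p. 7 L1–12)] -/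
theorem exists_unit_fs_eq_sqSMul_level (k : ℕ) (v : HeightOneSpectrum (𝓞 K)) :
    ∃ u w : Rk k, w * u = 1 ∧ (v ∈ S.L → ∀ n : Finset (HeightOneSpectrum (𝓞 K)), v ∉ n →
      insert v n ∈ (S.t k).levelSet →
      ∀ c ∈ unramifiedSubgroup (GaloisRep.toLocal v ((S.LD k).ρq (insert v n))) 1,
        fs₂ k (insert v n) v c =
          (S.LD k).sqSMul (hy.scalarLinear k) (insert v n) v u ((S.LD k).fs (insert v n) v c)) := by
  by_cases hvL : v ∈ S.L
  swap
  · exact ⟨1, 1, one_mul 1, fun h => absurd h hvL⟩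
  -- the pair `({λ}, λ)`
  set m : Finset (HeightOneSpectrum (𝓞 K)) := insert v ∅ with hm_def
  have hvm : v ∈ m := Finset.mem_insert_self v ∅
  have hmL : m ∈ levels S.L := by
    intro w hw
    rw [Finset.mem_coe, Finset.mem_insert] at hw
    rcases hw with rfl | hw
    · exact hvL
    · exact absurd hw (Finset.notMem_empty _)
  have hm : m ∈ (S.t k).levelSet := by
    change m ∈ levels (S.t k).primes; rw [hy.primes_eq]; exact hmL
  have hadm : (S.LD k).IsFsAdmissible :=
    S.fs_admissible_of_fs_eq_tameSlotOn_levels pins hy.primes_eq hP htame k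
  have htriv : ∀ (σ : absoluteGaloisGroup (v.adicCompletion K)) (x : Nq k m),
      GaloisRep.toLocal v ((S.LD k).ρq m) σ x = x := (hP k m v ⟨hmL, hvm⟩).1
  obtain ⟨x₀, φ, hφ⟩ := S.exists_unimodular_levelQuotient hy k m
  obtain ⟨u, hu, hrel⟩ := (S.LD k).exists_unit_fs_eq_sqSMul_of_natural (hy.scalarLinear k) htriv
    (S.isTorsionBySet_levelQuotient k m) x₀ φ hφ
    (evalClass (GaloisRep.toLocal v ((S.LD k).ρq m)) htriv (pins v).frob)
    (evalClass_bijective_unramified _ htriv (pins v).isFrobPow)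
    (fun g hg c => evalClass_localH1Map ((S.LD k).ρq m) ((S.LD k).ρq m) v g.toAddMonoidHom hg htriv htriv _ c)
    (hadm.fsNaturalAt hm hm hvm hvm) (hadm.fsBijectiveAt hm hvm) (fs₂ k m v)
    (fun g hg c hc => (h2adm k).fsNaturalAt hm hm hvm hvm g hg c hc) ((h2adm k).fsBijectiveAt hm hvm)
  -- a unit of `R_k`: either `I_m` is proper, or `T^{(k)}/I_n = 0` for every `n ∋ λ` and `u := 1` works
  by_cases hI : levelIdeal (R := Rk k) (S.T.ρ k) m = ⊤
  · refine ⟨1, 1, one_mul 1, fun _ n hvn hn c hc => ?_⟩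
    -- `I_{nλ} ⊇ I_λ = R_k` kills `T^{(k)}/I_{nλ}`: the local `H¹` is trivial
    have hsub : Subsingleton (Nq k (insert v n)) := by
      refine ⟨fun a b => ?_⟩
      have h0 : ∀ y : Nq k (insert v n), y = 0 := fun y => by
        have h1 := S.isTorsionBySet_levelQuotient k (insert v n) (x := y)
          (a := ⟨1, by
            have : levelIdeal (R := Rk k) (S.T.ρ k) m ≤ levelIdeal (R := Rk k) (S.T.ρ k) (insert v n) :=
              levelIdeal_mono _ (Finset.insert_subset_iff.mpr ⟨Finset.mem_insert_self v n, Finset.empty_subset _⟩)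
            exact this (hI ▸ Submodule.mem_top)⟩)
        simpa using h1
      rw [h0 a, h0 b]
    haveI := subsingleton_galoisCohomology_one (GaloisRep.toLocal v ((S.LD k).ρq (insert v n)))
    obtain rfl : c = 0 := Subsingleton.elim _ _
    have e1 : fs₂ k (insert v n) v 0 = 0 := map_zero _
    have e2 : (S.LD k).fs (insert v n) v 0 = 0 := map_zero _
    exact e1.trans (((congrArg (⇑((S.LD k).sqSMul (hy.scalarLinear k) (insert v n) v 1)) e2).trans
      (map_zero _)).symm)
  · obtain ⟨w, hwu⟩ := exists_mul_eq_one_of_isUnit_mk hI hu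
    refine ⟨u, w, hwu, fun _ n hvn hn => ?_⟩
    -- transfer along `T^{(k)}/I_λ ↠ T^{(k)}/I_{nλ}`
    have hsub : m ⊆ insert v n :=
      Finset.insert_subset_iff.mpr ⟨Finset.mem_insert_self v n, Finset.empty_subset _⟩
    exact (S.LD k).fs_eq_sqSMul_transfer (hy.scalarLinear k) _
      (fun _ x => ((S.LD k).isQuotientBy m).transition_equivariant ((S.LD k).isQuotientBy (insert v n))
        (levelIdeal_mono (S.T.ρ k) hsub) _ x)
      (S.exists_mem_unramified_transition_eq hy k hsub hm hn hvm)
      (hadm.fsNaturalAt hm hn hvm (Finset.mem_insert_self v n)) (fs₂ k m v) (fs₂ k (insert v n) v)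
      (fun c hc => (h2adm k).fsNaturalAt hm hn hvm (Finset.mem_insert_self v n) _ _ c hc) u hrel


include hy htame h2adm h2red in
/-- **Levelwise units relating an admissible slot family to the tame slots, with their compatibility across the
reductions.**  There are `u_k, w_k : 𝓛 → R_k` with `w_k u_k = 1`, `fs₂ = ((u_k ℓ•) ⊗ 1) ∘ fs_tame` on the finite
classes at every `(nλ, λ)` of level `k` (`IsRescaledFs`), and — the only compatibility the transport of Kolyvagin
systems needs — `red(w_{k+1} ℓ)` and `w_k ℓ` ACT IDENTICALLY on `T^{(k)}/I_n` for `λ ∈ n ∈ 𝓝(𝓛)`: `red(u_{k+1} ℓ)` is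
valid at level `k` (`fs_eq_sqSMul_transfer_red`, `rqLocH1` onto on the finite classes), and two valid scalars act
identically on `T^{(k)}/I_λ ↠ T^{(k)}/I_n` (`LevelData.smul_eq_smul_of_fs_eq_sqSMul`).  No stationarity in `k`, no
completeness of `R` is used.
[cite: Howard2004HeegnerKolyvagin, Def. 1.1.8, Def. 1.2.3 and §1.6 (arXiv p. 5 L126–149, p. 7 L1–12, p. 11 L45–54)] -/
theorem exists_levelwise_units :
    ∃ u w : ∀ k, HeightOneSpectrum (𝓞 K) → Rk k,
      (∀ k v, w k v * u k v = 1) ∧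
      (∀ k, (S.LD k).IsRescaledFs (hy.scalarLinear k) (fs₂ k) (u k)) ∧
      (∀ k (n : Finset (HeightOneSpectrum (𝓞 K))), n ∈ (S.t k).levelSet → ∀ v ∈ n, ∀ y : Nq k n,
        S.redR k (w (k + 1) v) • y = w k v • y) := by
  have H := fun k v => S.exists_unit_fs_eq_sqSMul_level hy pins hP htame fs₂ h2adm k v
  choose u w hwu hrel using H
  have hvL_of : ∀ {k} {n : Finset (HeightOneSpectrum (𝓞 K))} {v}, n ∈ (S.t k).levelSet → v ∈ n → v ∈ S.L := by
    intro k n v hn hv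
    have h := hn hv
    rw [hy.primes_eq k] at h
    exact h
  refine ⟨u, w, hwu, fun k => ?_, fun k n hn v hv y => ?_⟩
  · intro n v hvn hins c hc
    exact hrel k v (hvL_of hins (Finset.mem_insert_self v n)) n hvn hins c hc
  · have hvL : v ∈ S.L := hvL_of hn hv
    -- the pair `({λ}, λ)` at the levels `k` and `k + 1`
    set m : Finset (HeightOneSpectrum (𝓞 K)) := insert v ∅ with hm_def
    have hvm : v ∈ m := Finset.mem_insert_self v ∅
    have hmL : m ∈ levels S.L := by
      intro x hx
      rw [Finset.mem_coe, Finset.mem_insert] at hx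
      rcases hx with rfl | hx
      · exact hvL
      · exact absurd hx (Finset.notMem_empty _)
    have hm0 : m ∈ (S.t k).levelSet := by
      change m ∈ levels (S.t k).primes; rw [hy.primes_eq]; exact hmL
    have hm1 : m ∈ (S.t (k + 1)).levelSet := by
      change m ∈ levels (S.t (k + 1)).primes; rw [hy.primes_eq]; exact hmL
    have hadm : (S.LD k).IsFsAdmissible :=
      S.fs_admissible_of_fs_eq_tameSlotOn_levels pins hy.primes_eq hP htame k
    -- `red(u_{k+1} λ)` is valid at level `k`
    obtain ⟨r, hr⟩ := hy.algebraMap_surjective (k + 1) (u (k + 1) v)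
    have hrel1 : ∀ c ∈ unramifiedSubgroup (GaloisRep.toLocal v ((S.LD (k + 1)).ρq m)) 1,
        fs₂ (k + 1) m v c = (S.LD (k + 1)).sqSMul (hy.scalarLinear (k + 1)) m v
          (algebraMap R (Rk (k + 1)) r) ((S.LD (k + 1)).fs m v c) := by
      rw [hr]; exact hrel (k + 1) v hvL ∅ (Finset.notMem_empty v) hm1
    have hrel0 := S.fs_eq_sqSMul_transfer_red hy.scalarLinear k m v
      (S.fs_natural_of_fs_eq_tameSlotOn pins (fun n v => n ∈ levels S.L ∧ v ∈ n) hP htame hy.fsQ_spec k m v)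
      (hy.fsQ_spec k m v) (S.exists_mem_unramified_rqLocH1_eq hy k hm0 hm1 hvm) (fun k => fs₂ k m v)
      (fun c _ => h2red k m v c) r hrel1
    have hrk : algebraMap R (Rk k) r = S.redR k (u (k + 1) v) := by rw [← hr, hy.redR_comp]
    -- two valid scalars act identically on `T^{(k)}/I_λ`, hence on `T^{(k)}/I_n`
    have huu : ∀ y₀ : Nq k m, u k v • y₀ = S.redR k (u (k + 1) v) • y₀ := fun y₀ => by
      rw [← hrk]
      exact LevelData.smul_eq_smul_of_fs_eq_sqSMul (S.LD k) (hy.scalarLinear k) hm0 hvm (hP k m v ⟨hmL, hvm⟩)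
        (pins v) (hadm.fsBijectiveAt hm0 hvm) (fs₂ k m v) _ _ (hrel k v hvL ∅ (Finset.notMem_empty v) hm0)
        hrel0 y₀
    have hsub : m ⊆ n := Finset.insert_subset_iff.mpr ⟨hv, Finset.empty_subset _⟩
    have key : u k v • y = S.redR k (u (k + 1) v) • y := by
      obtain ⟨y₀, rfl⟩ := S.transition_surjective k hsub y
      rw [← LinearMap.map_smul, ← LinearMap.map_smul, huu]
    have hba : w k v * u k v = 1 := hwu k v
    have hba' : S.redR k (w (k + 1) v) * S.redR k (u (k + 1) v) = 1 := by rw [← map_mul, hwu, map_one]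
    calc S.redR k (w (k + 1) v) • y
        = (S.redR k (w (k + 1) v) * (w k v * u k v)) • y := by rw [hba, mul_one]
      _ = (S.redR k (w (k + 1) v) * w k v) • (u k v • y) := by rw [← mul_assoc, mul_smul]
      _ = (S.redR k (w (k + 1) v) * w k v) • (S.redR k (u (k + 1) v) • y) := by rw [key]
      _ = (w k v * (S.redR k (w (k + 1) v) * S.redR k (u (k + 1) v))) • y := by
          rw [smul_smul, mul_comm (S.redR k (w (k + 1) v)) (w k v), mul_assoc]
      _ = w k v • y := by rw [hba', mul_one]

end DVRSetting

end Literature.NumberTheory.GaloisCohomology.Howard2004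

end
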